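import Mathlib
import HarnessLib
import Summits.ResolutionOfSingularities.ResolutionOfSingularities.Theorems.WildQuotientsWildQuotientResolutionToricExitTransferFourOneShot
import Summits.ResolutionOfSingularities.ResolutionOfSingularities.Theorems.WildQuotientsWildQuotientResolutionJordanFiveFrameDefs
import Summits.ResolutionOfSingularities.ResolutionOfSingularities.Theorems.WildQuotientsWildQuotientResolutionJordanFiveOrder
import Summits.ResolutionOfSingularities.ResolutionOfSingularities.Theorems.WildQuotientsWildQuotientResolutionToricExitCover
import Summits.ResolutionOfSingularities.ResolutionOfSingularities.Theorems.WildQuotientsWildQuotientResolutionToricExitChartStable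
import Summits.ResolutionOfSingularities.ResolutionOfSingularities.Theorems.WildQuotientsWildQuotientResolutionToricExitJordanThreeBrickNonempty
import Summits.ResolutionOfSingularities.ResolutionOfSingularities.Theorems.WildQuotientsWildQuotientResolutionAffineQuotientData
import Summits.ResolutionOfSingularities.ResolutionOfSingularities.Theorems.WildQuotientsWildQuotientResolutionAffineQuotientEtale
import Summits.ResolutionOfSingularities.ResolutionOfSingularities.Theorems.WildQuotientsWildQuotientResolutionLinearSmallBlocksAlgebra
import Summits.ResolutionOfSingularities.ResolutionOfSingularities.Theorems.WildQuotientsWildQuotientResolutionFixedPointsRegular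
import Summits.ResolutionOfSingularities.ResolutionOfSingularities.Theorems.WildQuotientsWildQuotientResolutionFixedPointsGraded
import Summits.ResolutionOfSingularities.ResolutionOfSingularities.Theorems.WildQuotientsGaloisQuotientStableCover
import Literature.AlgebraicGeometry.Resolution.AffineBlowupIntegral
import Literature.AlgebraicGeometry.Resolution.BlowupPrincipalCharts
import Literature.AlgebraicGeometry.Resolution.BlowupsEquivariant

/-!
# RUNG V5 SCAFFOLD (variant β‴): the `J₅` toric exit with four pieces and a ONE-SHOT `μ₄` brick

`JordanFive.jordanFive_hasResolution_of_bricks` — the `J₅` toric exit with FOUR pieces assembled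
modulo its bricks (crux stmt-ResolutionOfSingularities-15640; plan-1 NAMING 2026-08-27T10:09:28Z;
design RT-J5 §2–§6 / RT-LADDER §3). THIS FILE IS THE CONTRACT: the binder TYPES below are what the
brick seats type against (vocabulary = `…JordanFiveFrameDefs.lean`, p523816: `JordanFive.gens12`,
`I12`, `chart`, `fixLocus`, `vertexCurve`, `edgeSurface`); the body is the four-piece ONE-SHOT transfer
`ToricExit.toricExitTransfer₄'` (HP0-ONESHOT-DESIGN.md §1–3, res-L1-w45c-plan-1 RULING v8.4-B): identical
to `jordanFive_hasResolution_of_bricks` (p527978) except that the `μ₄` brick `HP₀` is ONE-SHOT —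
«some blow-up of `V[x_a³]/G` along `𝓘_{Z₀} · (𝓘_{Z₀}² : 𝓘_{A₀})` is regular», `Z₀`/`A₀` the reduced
images of the edge surface / the `μ₄` vertex curve. [OURS · L1 W4.5c] — NOT a statement of any manuscript. Lead res-L1-w45c-lead-1.

Discharged here (not bricks): the crux data of `𝔸ⁿ → 𝔸ⁿ/⟨σ⟩` (`AffineQuotient.*`, order `p` by
`JordanFive.card_zpowers_prime`, generic étaleness over `D(x_a)`), the model (`I₁₂ ∋ x_a³ ≠ 0`:
integral, proper, birational), the `G`-stability of `V[x_a³]` (`σ x_a³ = x_a³`), the terminal piece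
`O₃ = ⋂ g·V[x_d¹²]` and its non-emptiness, the cover `⋃_j V[g_j] = V`, the closedness of the first
centre `T = edgeSurface ∪ vertexCurve 1` and the emptiness relations that hold BY DEFINITION of the
loci (`T ∩ V[x_d¹²] = ∅`, `vertexCurve 1 ∩ V[x_a³] = ∅`, `vertexCurve 0 ∩ V[x_d¹²] = ∅`).

PIECES: `O₀ = chart 0 = V[x_a³]` (μ₄), `O₁ = W₁` (μ₃ twisted-chart open, ABSTRACT), `O₂ = W₂`
(μ₂-HIGH open, ABSTRACT), `O₃ = ⋂ g • chart 3` (`chart 3 = V[x_d¹²]`, terminal).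
CENTRES: first `T = edgeSurface ∪ vertexCurve 1` (reduced image downstairs), second (piece 0 only)
supported over `vertexCurve 0`.

BRICKS (owner per plan-1 10:09:28Z / lead-1 10:22:53Z; «?» = UNOWNED):
* `hJ`      — `I₁₂`-ideal sheaf is `ρ`-stable (lead-1, frame file)                       [B1]
* `HregD`, `HdivD` — `V[x_d¹²]` regular; principal stalk augmentation at its fixed points [B8 ?]
* `W₁`, `HW₁st`, `HW₁aff` — the μ₃ twisted-chart open, stable, affine                    [B3 stub-1/2]
* `W₂`, `HW₂st`, `HW₂aff` — the μ₂-HIGH open, stable, affine                              [B7 ?]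
* `Hcov`    — `chart 0 ⊔ W₁ ⊔ W₂ ⊔ chart 3 = ⊤`                                            [cover ?]
* `HS₁`, `HA₁`, `HB₂`, `HA₂` — `edgeSurface ∩ W₁ = ∅`, `vertexCurve 0 ∩ W₁ = ∅`,
  `vertexCurve 1 ∩ W₂ = ∅`, `vertexCurve 0 ∩ W₂ = ∅`                                      [W-side]
* `HP₁`     — μ₃ CONE BRICK: some blow-up of `W₁/G` along the reduced image of `vertexCurve 1`
              is regular (SliceX1 + T3 + transfer p505172)                                 [B3+B4]
* `HP₂`     — μ₂-HIGH BRICK: some blow-up of `W₂/G` along the reduced image of `edgeSurface`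
              is regular (card H, K–L at 2)                                                [B7 ?]
* `HP₀`     — μ₄ ONE-SHOT BRICK: some blow-up of `V[x_a³]/G` along `𝓘_{Z₀}·(𝓘_{Z₀}² : 𝓘_{A₀})`
              (`Z₀` = reduced image of `edgeSurface`, `A₀` = of `vertexCurve 0`) is regular
              (stub-2 X0-model + stub-4 `Quarter1123.blowup_regular` through
              `coneBrick_zero_of_ringBrick'`)                                               [B2+B5]
-/

set_option linter.dupNamespace false

noncomputable section

open CategoryTheory AlgebraicGeometry TopologicalSpace MvPolynomial
open Literature.AlgebraicGeometry.Resolution Literature.AlgebraicGeometry.RelativeSpec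

namespace Summit.ResolutionOfSingularities.ResolutionOfSingularities.Theorems.WildQuotientResolution.JordanFive

-- the glued-quotient / blow-up bookkeeping is individually cheap but numerous
set_option maxHeartbeats 1600000 in
/-- **The J₅ toric exit modulo its bricks, one-shot `μ₄` piece** (see the module docstring for the bricks `hJ`, `HregD`,
`HdivD`, `HW₁st`, `HW₁aff`, `HW₂st`, `HW₂aff`, `Hcov`, `HS₁`, `HA₁`, `HB₂`, `HA₂`, `HP₁`, `HP₂`, `HP₀`).
[OURS · L1 W4.5c] [folklore; assembly of landed decls] -/
theorem jordanFive_hasResolution_of_bricks' (p : ℕ) (hp : p.Prime) (hp5 : 5 ≤ p)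
    (k : Type) [Field k] [CharP k p] (n : ℕ)
    (σ : MvPolynomial (Fin n) k ≃ₐ[k] MvPolynomial (Fin n) k) [Finite ↥(Subgroup.zpowers σ)]
    (a b c d e : Fin n) (hab : a ≠ b) (hac : a ≠ c) (had : a ≠ d) (hae : a ≠ e) (_hbc : b ≠ c)
    (_hbd : b ≠ d) (_hbe : b ≠ e) (_hcd : c ≠ d) (_hce : c ≠ e) (_hde : d ≠ e)
    (hb : σ (X b) = X b + X a) (hc : σ (X c) = X c + X b) (hd : σ (X d) = X d + X c)
    (he : σ (X e) = X e + X d)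
    (hσ : ∀ i, i ≠ b → i ≠ c → i ≠ d → i ≠ e → σ (X i) = X i)
    (hJ : ∀ (ρ : ↥(Subgroup.zpowers σ) →* Aut (Spec (CommRingCat.of (MvPolynomial (Fin n) k))))
      (_ : ∀ g : ↥(Subgroup.zpowers σ), (ρ g).hom = Spec.map (CommRingCat.ofHom
        ((MulSemiringAction.toRingEquiv (↥(Subgroup.zpowers σ)) (MvPolynomial (Fin n) k) g⁻¹ :
          MvPolynomial (Fin n) k ≃+* MvPolynomial (Fin n) k) :
            MvPolynomial (Fin n) k →+* MvPolynomial (Fin n) k)))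
      (g : ↥(Subgroup.zpowers σ)),
      (affineBlowup.idealSheaf (I12 k n a b c d)).comap (ρ g).hom =
        affineBlowup.idealSheaf (I12 k n a b c d))
    -- [B8] terminal chart `V[x_d¹²]`: regular, principal stalk augmentation at fixed points
    (HregD : ∀ v ∈ chart k n a b c d 3,
      IsRegularLocalRing ((affineBlowup (I12 k n a b c d)).presheaf.stalk v))
    (HdivD : ∀ (ρ : ↥(Subgroup.zpowers σ) →* Aut (Spec (CommRingCat.of (MvPolynomial (Fin n) k))))
      (hρ : ∀ g : ↥(Subgroup.zpowers σ), (ρ g).hom = Spec.map (CommRingCat.ofHom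
        ((MulSemiringAction.toRingEquiv (↥(Subgroup.zpowers σ)) (MvPolynomial (Fin n) k) g⁻¹ :
          MvPolynomial (Fin n) k ≃+* MvPolynomial (Fin n) k) :
            MvPolynomial (Fin n) k →+* MvPolynomial (Fin n) k)))
      (g : ↥(Subgroup.zpowers σ)) (v : affineBlowup (I12 k n a b c d))
      (hv : (((affineBlowup.isBlowup (I12 k n a b c d)).liftAction ρ (hJ ρ hρ)) g).hom.base v = v),
      v ∈ chart k n a b c d 3 →
      (Ideal.span (Set.range fun s =>
        ((affineBlowup (I12 k n a b c d)).presheaf.stalkSpecializes (specializes_of_eq hv) ≫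
          (((affineBlowup.isBlowup (I12 k n a b c d)).liftAction ρ (hJ ρ hρ)) g).hom.stalkMap v).hom
            s - s)).IsPrincipal)
    -- [B3] the μ₃ twisted-chart open `W₁` and [B7] the μ₂-HIGH open `W₂`: stable, affine
    (W₁ W₂ : (affineBlowup (I12 k n a b c d)).Opens)
    (HW₁st : ∀ (ρ : ↥(Subgroup.zpowers σ) →* Aut (Spec (CommRingCat.of (MvPolynomial (Fin n) k))))
      (hρ : ∀ g : ↥(Subgroup.zpowers σ), (ρ g).hom = Spec.map (CommRingCat.ofHom
        ((MulSemiringAction.toRingEquiv (↥(Subgroup.zpowers σ)) (MvPolynomial (Fin n) k) g⁻¹ :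
          MvPolynomial (Fin n) k ≃+* MvPolynomial (Fin n) k) :
            MvPolynomial (Fin n) k →+* MvPolynomial (Fin n) k)))
      (g : ↥(Subgroup.zpowers σ)),
      (((affineBlowup.isBlowup (I12 k n a b c d)).liftAction ρ (hJ ρ hρ)) g).hom ⁻¹ᵁ W₁ = W₁)
    (HW₁aff : IsAffineOpen W₁)
    (HW₂st : ∀ (ρ : ↥(Subgroup.zpowers σ) →* Aut (Spec (CommRingCat.of (MvPolynomial (Fin n) k))))
      (hρ : ∀ g : ↥(Subgroup.zpowers σ), (ρ g).hom = Spec.map (CommRingCat.ofHom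
        ((MulSemiringAction.toRingEquiv (↥(Subgroup.zpowers σ)) (MvPolynomial (Fin n) k) g⁻¹ :
          MvPolynomial (Fin n) k ≃+* MvPolynomial (Fin n) k) :
            MvPolynomial (Fin n) k →+* MvPolynomial (Fin n) k)))
      (g : ↥(Subgroup.zpowers σ)),
      (((affineBlowup.isBlowup (I12 k n a b c d)).liftAction ρ (hJ ρ hρ)) g).hom ⁻¹ᵁ W₂ = W₂)
    (HW₂aff : IsAffineOpen W₂)
    (Hcov : chart k n a b c d 0 ⊔ W₁ ⊔ W₂ ⊔ chart k n a b c d 3 = ⊤)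
    (HS₁ : Disjoint (edgeSurface k n a b c d) (W₁ : Set (affineBlowup (I12 k n a b c d))))
    (HA₁ : Disjoint (vertexCurve k n a b c d 0) (W₁ : Set (affineBlowup (I12 k n a b c d))))
    (HB₂ : Disjoint (vertexCurve k n a b c d 1) (W₂ : Set (affineBlowup (I12 k n a b c d))))
    (HA₂ : Disjoint (vertexCurve k n a b c d 0) (W₂ : Set (affineBlowup (I12 k n a b c d))))
    -- [B3+B4] the μ₃ CONE BRICK on `W₁/G`, centre = reduced image of the μ₃ vertex curve
    (HP₁ : ∀ (ρ : ↥(Subgroup.zpowers σ) →* Aut (Spec (CommRingCat.of (MvPolynomial (Fin n) k))))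
      (hρ : ∀ g : ↥(Subgroup.zpowers σ), (ρ g).hom = Spec.map (CommRingCat.ofHom
        ((MulSemiringAction.toRingEquiv (↥(Subgroup.zpowers σ)) (MvPolynomial (Fin n) k) g⁻¹ :
          MvPolynomial (Fin n) k ≃+* MvPolynomial (Fin n) k) :
            MvPolynomial (Fin n) k →+* MvPolynomial (Fin n) k)))
      (ρB : ActionOver
        (affineBlowup.π (I12 k n a b c d) ≫
          Spec.map (CommRingCat.ofHom (algebraMap
            (FixedPoints.subalgebra k (MvPolynomial (Fin n) k) (Subgroup.zpowers σ))
            (MvPolynomial (Fin n) k))))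
        ↥(Subgroup.zpowers σ))
      (_ : ρB.aut = (affineBlowup.isBlowup (I12 k n a b c d)).liftAction ρ (hJ ρ hρ))
      (O₁ : ρB.StableAffineOpens) (_ : O₁.1 = W₁)
      (Z₁ : Closeds (ρB.pieceQuot O₁)),
      (Z₁ : Set (ρB.pieceQuot O₁)) =
        (ρB.pieceMk O₁).base '' (O₁.1.ι.base ⁻¹' vertexCurve k n a b c d 1) →
      ∃ (B : Scheme.{0}) (pB : B ⟶ ρB.pieceQuot O₁),
        IsBlowup pB (Scheme.IdealSheafData.vanishingIdeal Z₁) ∧ Scheme.IsRegular B)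
    -- [B7] the μ₂-HIGH BRICK on `W₂/G`, centre = reduced image of the edge surface
    (HP₂ : ∀ (ρ : ↥(Subgroup.zpowers σ) →* Aut (Spec (CommRingCat.of (MvPolynomial (Fin n) k))))
      (hρ : ∀ g : ↥(Subgroup.zpowers σ), (ρ g).hom = Spec.map (CommRingCat.ofHom
        ((MulSemiringAction.toRingEquiv (↥(Subgroup.zpowers σ)) (MvPolynomial (Fin n) k) g⁻¹ :
          MvPolynomial (Fin n) k ≃+* MvPolynomial (Fin n) k) :
            MvPolynomial (Fin n) k →+* MvPolynomial (Fin n) k)))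
      (ρB : ActionOver
        (affineBlowup.π (I12 k n a b c d) ≫
          Spec.map (CommRingCat.ofHom (algebraMap
            (FixedPoints.subalgebra k (MvPolynomial (Fin n) k) (Subgroup.zpowers σ))
            (MvPolynomial (Fin n) k))))
        ↥(Subgroup.zpowers σ))
      (_ : ρB.aut = (affineBlowup.isBlowup (I12 k n a b c d)).liftAction ρ (hJ ρ hρ))
      (O₂ : ρB.StableAffineOpens) (_ : O₂.1 = W₂)
      (Z₂ : Closeds (ρB.pieceQuot O₂)),
      (Z₂ : Set (ρB.pieceQuot O₂)) =
        (ρB.pieceMk O₂).base '' (O₂.1.ι.base ⁻¹' edgeSurface k n a b c d) →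
      ∃ (B : Scheme.{0}) (pB : B ⟶ ρB.pieceQuot O₂),
        IsBlowup pB (Scheme.IdealSheafData.vanishingIdeal Z₂) ∧ Scheme.IsRegular B)
    -- [B2+B5] the μ₄ ONE-SHOT BRICK on `V[x_a³]/G`, centre `𝓘_{Z₀} · (𝓘_{Z₀}² : 𝓘_{A₀})`
    (HP₀ : ∀ (ρ : ↥(Subgroup.zpowers σ) →* Aut (Spec (CommRingCat.of (MvPolynomial (Fin n) k))))
      (hρ : ∀ g : ↥(Subgroup.zpowers σ), (ρ g).hom = Spec.map (CommRingCat.ofHom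
        ((MulSemiringAction.toRingEquiv (↥(Subgroup.zpowers σ)) (MvPolynomial (Fin n) k) g⁻¹ :
          MvPolynomial (Fin n) k ≃+* MvPolynomial (Fin n) k) :
            MvPolynomial (Fin n) k →+* MvPolynomial (Fin n) k)))
      (ρB : ActionOver
        (affineBlowup.π (I12 k n a b c d) ≫
          Spec.map (CommRingCat.ofHom (algebraMap
            (FixedPoints.subalgebra k (MvPolynomial (Fin n) k) (Subgroup.zpowers σ))
            (MvPolynomial (Fin n) k))))
        ↥(Subgroup.zpowers σ))
      (_ : ρB.aut = (affineBlowup.isBlowup (I12 k n a b c d)).liftAction ρ (hJ ρ hρ))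
      (O₀ : ρB.StableAffineOpens) (_ : O₀.1 = chart k n a b c d 0)
      (Z₀ A₀ : Closeds (ρB.pieceQuot O₀)),
      (Z₀ : Set (ρB.pieceQuot O₀)) =
        (ρB.pieceMk O₀).base '' (O₀.1.ι.base ⁻¹' edgeSurface k n a b c d) →
      (A₀ : Set (ρB.pieceQuot O₀)) =
        (ρB.pieceMk O₀).base '' (O₀.1.ι.base ⁻¹' vertexCurve k n a b c d 0) →
      ∃ (B : Scheme.{0}) (pB : B ⟶ ρB.pieceQuot O₀),
        IsBlowup pB (Scheme.IdealSheafData.vanishingIdeal Z₀ *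
          colon (Scheme.IdealSheafData.vanishingIdeal Z₀ ^ 2)
            (Scheme.IdealSheafData.vanishingIdeal A₀)) ∧ Scheme.IsRegular B) :
    Scheme.HasResolution
      (Spec (.of (FixedPoints.subalgebra k (MvPolynomial (Fin n) k) (Subgroup.zpowers σ)))) := by
  classical
  haveI : Fact (Nat.Prime p) := ⟨hp⟩
  have ha : σ (X a) = X a := hσ a hab hac had hae
  have hσp : σ ^ p = 1 :=
    pow_prime_eq_one k n σ a b c d e hab hac had hae hb hc hd he hσ p hp hp5
  have hcard : Nat.card (Subgroup.zpowers σ) = p :=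
    card_zpowers_prime k n σ a b c d e hab hac had hae hb hc hd he hσ p hp hp5
  have hn : 0 < n := Fin.pos a
  -- the rings: `S = k[x]`, `G = ⟨σ⟩`, `A = S^G`
  let S : Type := MvPolynomial (Fin n) k
  let G : Type := ↥(Subgroup.zpowers σ)
  let A : Subalgebra k S := FixedPoints.subalgebra k S G
  -- the action on `𝔸ⁿ`
  obtain ⟨ρ, hρ⟩ := AffineQuotient.exists_specAction S G
  -- the quotient data
  let fk : Spec (.of A) ⟶ Spec (.of k) := Spec.map (CommRingCat.ofHom (algebraMap k A))
  let q : Spec (.of S) ⟶ Spec (.of A) := Spec.map (CommRingCat.ofHom (algebraMap A S))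
  haveI : LocallyOfFiniteType fk := AffineQuotient.locallyOfFiniteType_specMap_fixedPoints k
  haveI : IsFinite q := AffineQuotient.isFinite_specMap_fixedPoints k
  have hsurj : Function.Surjective q.base := AffineQuotient.surjective_specMap_fixedPoints k
  have hρq : ∀ g : G, (ρ g).hom ≫ q = q := AffineQuotient.specAction_comp k ρ hρ
  have horb : ∀ x y : Spec (CommRingCat.of S), q.base x = q.base y →
      ∃ g : G, (ρ g).hom.base x = y :=
    fun x y hxy => AffineQuotient.exists_specAction_base_eq k ρ hρ x y hxy
  -- faithfulness of `ρ`
  have hfaith : Function.Injective ρ := by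
    intro g h hgh
    have h1 : (ρ g).hom = (ρ h).hom := by rw [hgh]
    rw [hρ, hρ] at h1
    have h2 := Spec.map_injective h1
    have h3 : ∀ x : S, g⁻¹ • x = h⁻¹ • x := fun x => by
      have := congrArg (fun f : CommRingCat.of S ⟶ CommRingCat.of S => f.hom x) h2
      simpa using this
    have h4 : g⁻¹ = h⁻¹ := Subtype.ext (AlgEquiv.ext fun x => h3 x)
    exact inv_injective h4
  -- generically étale: over `D(x_a)`
  have hXa : (X a : S) ∈ A := (TameTransfer.mem_fixedPoints_zpowers_iff_apply_eq σ (X a)).mpr ha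
  have ht0 : (⟨X a, hXa⟩ : A) ≠ 0 := fun h =>
    MvPolynomial.X_ne_zero a (congrArg Subtype.val h : ((⟨X a, hXa⟩ : A) : S) = ((0 : A) : S))
  have hU : ∃ U : (Spec (.of A)).Opens, Dense (U : Set (Spec (.of A))) ∧ Etale (q ∣_ U) :=
    AffineQuotient.exists_dense_etale_morphismRestrict k (⟨X a, hXa⟩ : A) ht0
      fun g hg => LinearSmallBlocks.X_mem_augIdeal_of_transvection k p hp σ a b ha hb hσp g hg
  -- `dim X₁ = n > 0`
  have hdim : ¬ topologicalKrullDim (Spec (CommRingCat.of A)) ≤ 0 := by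
    rw [AffineQuotient.topologicalKrullDim_spec_fixedPoints k,
      AffineQuotient.topologicalKrullDim_spec_mvPolynomial k n]
    have hn' : (0 : WithBot ℕ∞) < (n : WithBot ℕ∞) := by exact_mod_cast hn
    exact not_le.mpr hn'
  -- the model `V = Bl_{I₁₂} 𝔸ⁿ` with the lifted action
  let I : Ideal S := I12 k n a b c d
  have hπ : IsBlowup (affineBlowup.π I) (affineBlowup.idealSheaf I) := affineBlowup.isBlowup I
  have hIne : I ≠ ⊥ := by
    intro h
    have h0 : gens12 k n a b c d 0 ∈ I := gens12_mem_I12 k n a b c d 0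
    rw [h, Ideal.mem_bot] at h0
    exact pow_ne_zero 3 (X_ne_zero a) h0
  haveI hVint : IsIntegral (affineBlowup I) := affineBlowup.isIntegral hIne
  have hbir : IsBirational (affineBlowup.π I) := affineBlowup.isBirational hIne
  have hJ' : ∀ g : G, (affineBlowup.idealSheaf I).comap (ρ g).hom = affineBlowup.idealSheaf I :=
    hJ ρ hρ
  have hequiv : ∀ g : G, (hπ.liftAction ρ hJ' g).hom ≫ affineBlowup.π I =
      affineBlowup.π I ≫ (ρ g).hom := fun g => hπ.liftAction_hom_comp ρ hJ' g
  haveI : (Spec (CommRingCat.of A)).IsSeparated := inferInstance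
  let ρB : ActionOver (affineBlowup.π I ≫ q) G :=
    ⟨hπ.liftAction ρ hJ', fun g => by rw [← Category.assoc, hequiv g, Category.assoc, hρq g]⟩
  -- the sections `g_j` of `Γ(𝔸ⁿ, ⊤)` and the principal charts
  let ι₀ : S →+* Γ(Spec (CommRingCat.of S), ⊤) := (Scheme.ΓSpecIso (CommRingCat.of S)).inv.hom
  have hIdeal : (affineBlowup.idealSheaf I).ideal ⟨⊤, isAffineOpen_top _⟩ = I.map ι₀ := by
    change (Scheme.IdealSheafData.ofIdealTop _).ideal ⟨⊤, isAffineOpen_top _⟩ = _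
    rw [ideal_ofIdealTop_top]
  have hgj : ∀ j : Fin 40, ι₀ (gens12 k n a b c d j) ∈
      (affineBlowup.idealSheaf I).ideal ⟨⊤, isAffineOpen_top _⟩ :=
    fun j => by rw [hIdeal]; exact Ideal.mem_map_of_mem _ (gens12_mem_I12 k n a b c d j)
  have hchart : ∀ j : Fin 40, chart k n a b c d j = blowupChart (affineBlowup.π I)
      (affineBlowup.idealSheaf I) ⟨⊤, isAffineOpen_top _⟩ (ι₀ (gens12 k n a b c d j)) := fun j => rfl
  -- the charts cover `V`
  have hcovAll : ⨆ j, chart k n a b c d j = ⊤ := by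
    have hx : Ideal.span (Set.range fun j => ι₀ (gens12 k n a b c d j)) =
        (affineBlowup.idealSheaf I).ideal ⟨⊤, isAffineOpen_top _⟩ := by
      rw [hIdeal]
      change _ = Ideal.map ι₀ (Ideal.span (Set.range (gens12 k n a b c d)))
      rw [Ideal.map_span, ← Set.range_comp]
      rfl
    have h := hπ.iSup_blowupChart (U := ⟨⊤, isAffineOpen_top _⟩) (fun j => ι₀ (gens12 k n a b c d j)) hx
    rw [Scheme.Hom.preimage_top] at h
    exact h
  -- `V[x_a³]` is `G`-stable (`σ x_a = x_a`)
  have hsmulXa : ∀ g : G, g • (X a : S) = X a := by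
    intro g
    obtain ⟨z, hz⟩ := Subgroup.mem_zpowers_iff.mp g.2
    have hfix : (X a : S) ∈ MulAction.fixedBy S σ := ha
    have h := MulAction.fixedBy_subset_fixedBy_zpow S σ z hfix
    rw [hz] at h
    exact h
  have hsmulXa3 : ∀ g : G, g • (gens12 k n a b c d 0 : S) = gens12 k n a b c d 0 := fun g => by
    change g • (X a ^ 3 : S) = X a ^ 3
    rw [smul_pow', hsmulXa g]
  have h0_st : ∀ g : G, (hπ.liftAction ρ hJ' g).hom ⁻¹ᵁ chart k n a b c d 0 = chart k n a b c d 0 :=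
    fun g => ToricExit.preimage_blowupChart_eq_self_of_action hπ ρ (hπ.liftAction ρ hJ') hequiv hJ'
      (hgj 0) (fun g => ToricExit.specAction_appTop_ΓSpecIso_inv ρ hρ _ hsmulXa3 g) g
  -- the stable open `V[x_a³] ∪ W₁ ∪ W₂` and the stable affine piece `O₃ = ⋂ g·V[x_d¹²]`
  have hW₁_st : ∀ g : G, (hπ.liftAction ρ hJ' g).hom ⁻¹ᵁ W₁ = W₁ := fun g => HW₁st ρ hρ g
  have hW₂_st : ∀ g : G, (hπ.liftAction ρ hJ' g).hom ⁻¹ᵁ W₂ = W₂ := fun g => HW₂st ρ hρ g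
  have hAW_st : ∀ g : G, (hπ.liftAction ρ hJ' g).hom ⁻¹ᵁ (chart k n a b c d 0 ⊔ W₁ ⊔ W₂) =
      chart k n a b c d 0 ⊔ W₁ ⊔ W₂ := fun g => by
    rw [Scheme.Hom.preimage_sup, Scheme.Hom.preimage_sup, h0_st g, hW₁_st g, hW₂_st g]
  have h3_aff : IsAffineOpen (chart k n a b c d 3) := hπ.isAffineOpen_blowupChart (hgj 3)
  obtain ⟨hO₃_aff, hO₃_st, hO₃_le, hcov₃⟩ :=
    ToricExit.exists_stable_affine_cover_pair (hπ.liftAction ρ hJ') (chart k n a b c d 0 ⊔ W₁ ⊔ W₂)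
      (chart k n a b c d 3) hAW_st h3_aff Hcov
  haveI : IsAffine (chart k n a b c d 0 : Scheme.{0}) := hπ.isAffineOpen_blowupChart (hgj 0)
  haveI : IsAffine (W₁ : Scheme.{0}) := HW₁aff
  haveI : IsAffine (W₂ : Scheme.{0}) := HW₂aff
  haveI : IsAffine ((⨅ g : G, (hπ.liftAction ρ hJ' g).hom ⁻¹ᵁ chart k n a b c d 3 :
    (affineBlowup I).Opens) : Scheme.{0}) := hO₃_aff
  let O₀ : ρB.StableAffineOpens :=
    ⟨chart k n a b c d 0, h0_st, isAffineHom_of_isAffine_of_isSeparated _⟩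
  let O₁ : ρB.StableAffineOpens := ⟨W₁, hW₁_st, isAffineHom_of_isAffine_of_isSeparated _⟩
  let O₂ : ρB.StableAffineOpens := ⟨W₂, hW₂_st, isAffineHom_of_isAffine_of_isSeparated _⟩
  let O₃ : ρB.StableAffineOpens :=
    ⟨⨅ g : G, (hπ.liftAction ρ hJ' g).hom ⁻¹ᵁ chart k n a b c d 3, hO₃_st,
      isAffineHom_of_isAffine_of_isSeparated _⟩
  have hcov₄ : O₀.1 ⊔ O₁.1 ⊔ O₂.1 ⊔ O₃.1 = ⊤ := hcov₃
  -- `O₃` is non-empty: `V` is irreducible and `V[x_d¹²] ⊇ D₊(x_d¹² t) ≠ ∅`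
  have hO₃ne : ((O₃.1 : (affineBlowup I).Opens) : Set (affineBlowup I)).Nonempty := by
    haveI := hVint
    haveI := BlowupExit.nontrivial_away_reesT_of_ne_zero (I := I) (gens12 k n a b c d 3 : S)
      (gens12_mem_I12 k n a b c d 3) (by
        change (X d ^ 12 : S) ≠ 0
        exact pow_ne_zero 12 (X_ne_zero d))
    refine BlowupExit.nonempty_iInf_preimage_of_irreducibleSpace _ (fun g => ?_) _
      (BlowupExit.affineBlowup_blowupChart_nonempty (I := I) (gens12 k n a b c d 3 : S)
        (gens12_mem_I12 k n a b c d 3))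
    intro v
    refine ⟨(hπ.liftAction ρ hJ' g).inv.base v, ?_⟩
    rw [← Scheme.Hom.comp_apply, Iso.inv_hom_id]
    rfl
  -- piece `3` is regular
  have hreg₃ : Scheme.IsRegular ((O₃.1 : (affineBlowup I).Opens) : Scheme.{0}) := fun y => by
    haveI : IsRegularLocalRing ((affineBlowup I).presheaf.stalk
        ((O₃.1 : (affineBlowup I).Opens).ι.base y)) := HregD y.1 (hO₃_le y.2)
    exact IsRegularLocalRing.of_ringEquiv
      (asIso ((O₃.1 : (affineBlowup I).Opens).ι.stalkMap y)).commRingCatIsoToRingEquiv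
  -- the centres: `T = edgeSurface ∪ vertexCurve 1`, `T' = vertexCurve 0`
  have hFix : IsClosed (fixLocus k n a b c d) :=
    (PrimeSpectrum.isClosed_zeroLocus _).preimage (affineBlowup.π I).base.hom.continuous
  let T : Set (affineBlowup I) := edgeSurface k n a b c d ∪ vertexCurve k n a b c d 1
  have hT : IsClosed T := (hFix.sdiff (Opens.isOpen _)).union (hFix.sdiff (Opens.isOpen _))
  -- chart `3` misses the edge surface and the vertex curves `0`, `1`; chart `0` misses curve `1`
  have hS3 : Disjoint (edgeSurface k n a b c d) (chart k n a b c d 3 : Set (affineBlowup I)) := by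
    rw [Set.disjoint_left]
    intro v hv hv3
    exact hv.2 (Opens.mem_iSup.mpr ⟨⟨3, by decide⟩, hv3⟩)
  have hC13 : Disjoint (vertexCurve k n a b c d 1) (chart k n a b c d 3 : Set (affineBlowup I)) := by
    rw [Set.disjoint_left]
    intro v hv hv3
    exact hv.2 (Opens.mem_iSup.mpr ⟨⟨3, by decide⟩, hv3⟩)
  have hC03 : Disjoint (vertexCurve k n a b c d 0) (chart k n a b c d 3 : Set (affineBlowup I)) := by
    rw [Set.disjoint_left]
    intro v hv hv3
    exact hv.2 (Opens.mem_iSup.mpr ⟨⟨3, by decide⟩, hv3⟩)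
  have hC10 : Disjoint (vertexCurve k n a b c d 1) (chart k n a b c d 0 : Set (affineBlowup I)) := by
    rw [Set.disjoint_left]
    intro v hv hv0
    exact hv.2 (Opens.mem_iSup.mpr ⟨⟨0, by decide⟩, hv0⟩)
  have hO₃sub : ((O₃.1 : (affineBlowup I).Opens) : Set (affineBlowup I)) ⊆
      (chart k n a b c d 3 : Set (affineBlowup I)) := fun v hv => hO₃_le hv
  have hT₃ : Disjoint T ((O₃.1 : (affineBlowup I).Opens) : Set (affineBlowup I)) :=
    Disjoint.union_left (hS3.mono_right hO₃sub) (hC13.mono_right hO₃sub)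
  have hT'₃ : Disjoint (vertexCurve k n a b c d 0)
      ((O₃.1 : (affineBlowup I).Opens) : Set (affineBlowup I)) := hC03.mono_right hO₃sub
  -- traces of `T` on the pieces
  have trace : ∀ (O : (affineBlowup I).Opens) (P Q : Set (affineBlowup I)),
      Disjoint P (O : Set (affineBlowup I)) → O.ι.base ⁻¹' (P ∪ Q) = O.ι.base ⁻¹' Q := by
    intro O P Q hP
    ext x
    simp only [Set.preimage_union, Set.mem_union, Set.mem_preimage, or_iff_right_iff_imp]
    intro hx
    exact ((Set.disjoint_left.mp hP hx) (by simp)).elim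
  have trace' : ∀ (O : (affineBlowup I).Opens) (P Q : Set (affineBlowup I)),
      Disjoint Q (O : Set (affineBlowup I)) → O.ι.base ⁻¹' (P ∪ Q) = O.ι.base ⁻¹' P := by
    intro O P Q hQ
    rw [Set.union_comm]
    exact trace O Q P hQ
  -- the exit
  have hT'c : IsClosed (vertexCurve k n a b c d 0) := hFix.sdiff (Opens.isOpen _)
  refine ToricExit.toricExitTransfer₄' p hp k (Spec (.of S)) (Spec (.of A)) fk q G ρ hcard hfaith
    hdim hsurj hU horb (affineBlowup I) (affineBlowup.π I) hbir ρB hequiv O₀ O₁ O₂ O₃ hcov₄ hO₃ne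
    hreg₃ (fun g v hv hvO => HdivD ρ hρ g v hv (hO₃_le hvO)) T hT hT₃ (vertexCurve k n a b c d 0)
    hT'c HA₁ HA₂ hT'₃ ?_ ?_ ?_
  · -- piece `1`: `T ∩ W₁ = vertexCurve 1 ∩ W₁`
    intro Z₁ hZ₁
    rw [trace W₁ _ _ HS₁] at hZ₁
    exact HP₁ ρ hρ ρB rfl O₁ rfl Z₁ hZ₁
  · -- piece `2`: `T ∩ W₂ = edgeSurface ∩ W₂`
    intro Z₂ hZ₂
    rw [trace' W₂ _ _ HB₂] at hZ₂
    exact HP₂ ρ hρ ρB rfl O₂ rfl Z₂ hZ₂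
  · -- piece `0`: `T ∩ V[x_a³] = edgeSurface ∩ V[x_a³]`, colon by the μ₄ vertex curve
    intro Z₀ A₀ hZ₀ hA₀
    rw [trace' (chart k n a b c d 0) _ _ hC10] at hZ₀
    exact HP₀ ρ hρ ρB rfl O₀ rfl Z₀ A₀ hZ₀ hA₀

end Summit.ResolutionOfSingularities.ResolutionOfSingularities.Theorems.WildQuotientResolution.JordanFive

end
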